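import Literature.NumberTheory.Automorphic.SatakeTransformIwasawa
import Mathlib.GroupTheory.DoubleCoset
import Mathlib.GroupTheory.Index
import HarnessLib

/-!
# Duality of the Satake transform: left cosets of `KgK` with exponent `μ` against left cosets of `Kg⁻¹K`
# with exponent `-μ`, and the modulus of `P` as an index ratio (Cartier 1979 §I.3, §IV (4.2); Laumon (4.1.4)–(4.1.6))

Topic `NumberTheory/Automorphic`; namespace `Literature.NumberTheory.Automorphic` / `….IsIwasawaExponent` (lane
`lit-hodgefound`, Track 2 foundations; seat `lit-hodgefound-p11`, generation 44, row g44-#1).  THEOREMS ONLY: no definition,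
no named fact, no instance, no notation.  Sequel of the abstract engine `SatakeTransformIwasawa` (`IsIwasawaExponent`,
`IsIwasawaExponent.satakeTransform`).

## The mathematics

Let `a : G → Λ` be an Iwasawa exponent for `(P, K)` (`G = P·K`, `a` right `K`-invariant, left `P`-additive), `(G, K)` a Hecke
pair, `K_P = P ∩ K`, and for `g ∈ G`, `μ ∈ Λ` let `N(g, μ) = #{γ ∈ KgK/K : a(γ) = μ}` — the coefficient of `x^μ` in the
COUNTING transform `𝒮_1(T_g)` (`coeff_satakeTransform_doubleCosetOperator`).  The cosets counted by `N(g, μ)` are the `pK`,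
`p ∈ Z = P ∩ KgK ∩ a⁻¹(μ)`, i.e. `N(g, μ) = #(Z/K_P)`; inversion `p ↦ p⁻¹` turns `Z` into `P ∩ Kg⁻¹K ∩ a⁻¹(-μ)` and right
`K_P`-cosets into left ones, so `N(g⁻¹, -μ) = #(K_P\Z)`.  Both numbers are sums over the `(K_P, K_P)`-double cosets
`K_P p K_P ⊆ Z` of `[K_P : K_P ∩ pK_Pp⁻¹]`, resp. `[pK_Pp⁻¹ : K_P ∩ pK_Pp⁻¹]`, and the RATIO of these two indices is the value at
`p` of the modulus of `P` relative to `K_P`, which depends only on `a(p) = μ` as soon as `U = P ∩ a⁻¹(0)` is unimodular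
relative to `K_P` — here: every `y ∈ U` lies in a subgroup `V ⊇ K_P` with `[V : K_P] < ∞` (true for the unipotent radical of
a Borel subgroup, the union of its compact open subgroups `t⁻ᵏ K_P tᵏ`, §7).  Hence, for `t ∈ P` with `a(t) = μ`,

  `N(g, μ) · [tK_Pt⁻¹ : K_P ∩ tK_Pt⁻¹] = N(g⁻¹, -μ) · [K_P : K_P ∩ tK_Pt⁻¹]`            (`card_filter_mul_relIndex_eq`),

i.e. `N(g, μ) = δ(μ) N(g⁻¹, -μ)` with `δ(μ) = [K_P : K_P ∩ tK_Pt⁻¹] / [tK_Pt⁻¹ : K_P ∩ tK_Pt⁻¹]` the modulus character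
(`δ_{B(F)}(b) = d(b' b b'⁻¹)/db`, computed on the compact open `B(𝒪)` as `[B(𝒪) : B(𝒪) ∩ bB(𝒪)b⁻¹]/[bB(𝒪)b⁻¹ : B(𝒪) ∩ bB(𝒪)b⁻¹]`,
Laumon (4.1.4); Cartier §I.3: Haar measures of commensurable compact open subgroups are ratios of indices).  In terms of
the transforms: for weights `w, w'` with `[K_P : K_P ∩ tK_Pt⁻¹] · w(a t) = [tK_Pt⁻¹ : K_P ∩ tK_Pt⁻¹] · w'(-a t)` (e.g.
`w = w' = δ^{-1/2}`, Cartier's normalisation),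

  `𝒮_w(T_g) = ι(𝒮_{w'}(T_{g⁻¹}))`,  `ι(x^μ) = x^{-μ}`                        (`satakeTransform_doubleCosetOperator_eq_domCongr_neg`),

the compatibility of the Satake transform with the anti-involution `f ↦ f^∨`, `f^∨(g) = f(g⁻¹)`, of `ℋ(G, K)` and the antipode
of `R[Λ]` (`𝒮(f^∨)(χ) = 𝒮(f)(χ⁻¹)` for `𝒮 = 𝒮_{δ^{-1/2}}`; Cartier §IV (4.2): `Sf(m) = δ(m)^{1/2} ∫_N f(mn) dn`).  When every
double coset is self-inverse (`Kg⁻¹K = KgK`: `Sp_{2n}`, the unramified unitary groups — `-1 ∈ W`) the whole image of `𝒮_w` is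
`ι`-symmetric (`satakeTransform_eq_domCongr_neg_of_forall`): the `w₀ = -1` part of the `W`-invariance of the Satake image
(Cartier Thm. 4.1), and all of it in relative rank one.

## What is formalised (theorems only)

* §1 relative indices: `relIndex_conjAct_smul_of_mem` (`[V : xHx⁻¹ ∩ V] = [V : H ∩ V]`, `x ∈ V`),
  **`relIndex_conjAct_smul_comm_of_mem`** (relative unimodularity: `[xCx⁻¹ : C ∩ xCx⁻¹] = [C : C ∩ xCx⁻¹]` for `x ∈ V ⊇ C`,
  `[V : C] < ∞`), the COCYCLE **`relIndex_cocycle`** (`[A:A∩B][B:B∩C][C:C∩A] = [B:A∩B][C:B∩C][A:C∩A]` for pairwise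
  commensurable `A, B, C`), `relIndex_mul_relIndex_eq_of_relIndex_comm`.
* §2 `stabilizer_subgroup_mk`, **`ncard_orbit_subgroup_mk`** (`#(L·pK) = [L : L ∩ pKp⁻¹]`).
* §3 (Hecke pair) `relIndex_conjAct_smul_ne_zero`, `smul_inf_eq_of_mem`, `relIndex_conj_eq_of_mem`, commensurability of the
  `pK_Pp⁻¹`, `p ∈ P` (`relIndex_conj_conj_ne_zero`, `relIndex_conj_ne_zero`, `relIndex_conj_ne_zero'`).
* §4 (`IsIwasawaExponent P K a`) the finite sets `{γ ∈ KgK/K : a γ = μ}`: `mem_filter_orbit_iff`, stability under `K_P`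
  (`smul_mem_filter_orbit`, `orbit_subset_filter_orbit`), `P`-sections (`exists_section`), fibres of `γ ↦ K_P p_γ K_P` are
  `K_P`-orbits (`filter_doubleCoset_eq_finite_toFinset`, `card_filter_doubleCoset_eq_relIndex`), the inversion
  correspondence (`inv_mem_filter_orbit`, `doubleCoset_section_inv`, `conj_section_inv`, `image_doubleCoset_eq`).
* §5 **`card_filter_mul_relIndex_eq`** (THE DUALITY, in `ℕ`), `card_filter_eq_zero_of_forall_ne`,
  `relIndex_conj_mul_conj` (multiplicativity of the index ratio in `t`), `relIndex_conj_eq_of_apply_eq` (it depends on `a t`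
  only).
* §6 over `R`: `coeff_domCongr_neg`, **`satakeTransform_doubleCosetOperator_eq_domCongr_neg`** (`𝒮_w(T_g) = ι 𝒮_{w'}(T_{g⁻¹})`),
  **`satakeTransform_eq_domCongr_neg_of_forall`** (self-inverse double cosets ⇒ `𝒮_w(T) = ι 𝒮_{w'}(T)` for all `T`),
  `domCongr_neg_satakeTransform_eq_self` (`w = w'`: the image is `ι`-invariant).
* §7 `pow_smul_le_of_smul_le`, **`exists_subgroup_relIndex_ne_zero_of_contracting`**: the unimodularity hypothesis from a
  contracting element `t ∈ P` (`tK_Pt⁻¹ ⊆ K_P`, `tᵏ y t⁻ᵏ ∈ K` for `k ≫ 0`), as for Borel subgroups over local fields.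
* §8 (coefficients, every `T`) **`coeff_satakeTransform_mul_relIndex_eq_of_forall`**: if `T_{g⁻¹} = T_g` for all `g`, then
  `𝒮_w(T)_{a t} · w(-a t) · [tK_Pt⁻¹ : K_P ∩ tK_Pt⁻¹] = 𝒮_w(T)_{-a t} · w(a t) · [K_P : K_P ∩ tK_Pt⁻¹]` for EVERY `T ∈ ℋ(G, K; R)`
  and `t ∈ P` (the `R`-linear extension of §5), `coeff_satakeTransform_one_mul_relIndex_eq_of_forall` (`w = 1`).

## References
* [CartierCorvallis1979] P. Cartier, *Representations of 𝔭-adic groups: a survey*, PSPM 33.1 (1979), §I.3 (Hecke pairs, indices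
  and measures), §IV (4.2), Thm. 4.1.
* [Laumon1995] G. Laumon, *Cohomology of Drinfeld Modular Varieties I*, Cambridge Univ. Press (1996; doi 10.1017/cbo9780511666162), (4.1.4)–(4.1.6),
  Lemma (4.1.13) (held: `book:laumon1995-cohomology-drinfeld-modular-varieties`, pp. 75–77 of the text).
* [GetzHahn2024] J. R. Getz, H. Hahn, *An Introduction to Automorphic Representations*, GTM 300 (2024), §7.5 (7.17).
* [Macdonald1995] I. G. Macdonald, *Symmetric Functions and Hall Polynomials*, 2nd ed. (1995), Ch. V §3 (3.2)–(3.4).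
-/

noncomputable section

open scoped Pointwise
open MulAction MonoidAlgebra Finset ConjAct

namespace Literature.NumberTheory.Automorphic

variable {G : Type*} [Group G]

/-! ## §1 Relative indices: conjugation inside a bigger subgroup, relative unimodularity, the cocycle -/

/-- Conjugating by an element of `V` does not change the relative index in `V`: `[V : V ∩ xHx⁻¹] = [V : V ∩ H]` for `x ∈ V`.
[cite: CartierCorvallis1979, §I.3] -/
theorem relIndex_conjAct_smul_of_mem {V H : Subgroup G} {x : G} (hx : x ∈ V) :
    (toConjAct x • H).relIndex V = H.relIndex V := by
  have h := Subgroup.relIndex_pointwise_smul (toConjAct x) H V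
  rwa [Subgroup.conjAct_pointwise_smul_eq_self (Subgroup.le_normalizer hx)] at h

/-- A conjugate `xCx⁻¹` of `C ≤ V` by `x ∈ V` lies in `V`. [cite: CartierCorvallis1979, §I.3] -/
theorem conjAct_smul_le_of_mem {V C : Subgroup G} {x : G} (hx : x ∈ V) (hCV : C ≤ V) : toConjAct x • C ≤ V :=
  (Subgroup.pointwise_smul_le_pointwise_smul_iff.2 hCV).trans_eq
    (Subgroup.conjAct_pointwise_smul_eq_self (Subgroup.le_normalizer hx))

/-- **Relative unimodularity.**  If `C ≤ V` has finite index and `x ∈ V`, then `[xCx⁻¹ : C ∩ xCx⁻¹] = [C : C ∩ xCx⁻¹]`: both are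
`[V : C ∩ xCx⁻¹] / [V : C]` since `[V : xCx⁻¹] = [V : C]` (the Haar measures of the commensurable compact open subgroups
`C`, `xCx⁻¹` of the unimodular group `V` agree). [cite: CartierCorvallis1979, §I.3] -/
theorem relIndex_conjAct_smul_comm_of_mem {V C : Subgroup G} {x : G} (hx : x ∈ V) (hCV : C ≤ V)
    (hC : C.relIndex V ≠ 0) : (toConjAct x • C).relIndex C = C.relIndex (toConjAct x • C) := by
  have hBV : toConjAct x • C ≤ V := conjAct_smul_le_of_mem hx hCV
  have h1 := Subgroup.relIndex_mul_relIndex (toConjAct x • C ⊓ C) C V inf_le_right hCV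
  have h2 := Subgroup.relIndex_mul_relIndex (toConjAct x • C ⊓ C) (toConjAct x • C) V inf_le_left hBV
  rw [Subgroup.inf_relIndex_right] at h1
  rw [Subgroup.inf_relIndex_left, relIndex_conjAct_smul_of_mem hx] at h2
  exact mul_right_cancel₀ hC (h1.trans h2.symm)

/-- `[X : X ∩ Y ∩ Z] · [Y : X ∩ Y] = [Y : X ∩ Y ∩ Z] · [X : X ∩ Y]` (both sides are `[X ∩ Y : X ∩ Y ∩ Z] · [X : X ∩ Y] · [Y : X ∩ Y]`).
[cite: CartierCorvallis1979, §I.3] -/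
theorem relIndex_inf_inf_mul_relIndex (X Y Z : Subgroup G) :
    (X ⊓ Y ⊓ Z).relIndex X * X.relIndex Y = (X ⊓ Y ⊓ Z).relIndex Y * Y.relIndex X := by
  have hX := Subgroup.relIndex_mul_relIndex (X ⊓ Y ⊓ Z) (X ⊓ Y) X inf_le_left inf_le_left
  have hY := Subgroup.relIndex_mul_relIndex (X ⊓ Y ⊓ Z) (X ⊓ Y) Y inf_le_left inf_le_right
  rw [Subgroup.inf_relIndex_left (X ⊓ Y) Z, Subgroup.inf_relIndex_left X Y] at hX
  rw [Subgroup.inf_relIndex_left (X ⊓ Y) Z, Subgroup.inf_relIndex_right X Y] at hY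
  rw [← hX, ← hY]
  ring

/-- `[X : X ∩ Y ∩ Z] ≠ 0` when `[X : X ∩ Y]` and `[X : X ∩ Z]` are finite. [cite: CartierCorvallis1979, §I.3] -/
theorem relIndex_inf_inf_ne_zero {X Y Z : Subgroup G} (hY : Y.relIndex X ≠ 0) (hZ : Z.relIndex X ≠ 0) :
    (X ⊓ Y ⊓ Z).relIndex X ≠ 0 := by
  rw [inf_assoc, Subgroup.inf_relIndex_left]
  exact Subgroup.relIndex_inf_ne_zero hY hZ

/-- **The index cocycle.**  For pairwise commensurable subgroups `A, B, C`:
`[A : A ∩ B] · [B : B ∩ C] · [C : C ∩ A] = [B : A ∩ B] · [C : B ∩ C] · [A : C ∩ A]` — with `D = A ∩ B ∩ C`, both sides times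
`[A∩B : D][B∩C : D][C∩A : D]` equal `[A : D][B : D][C : D]` (the ratios `[A : A ∩ B]/[B : A ∩ B] = μ(B)⁻¹μ(A)`… form a cocycle).
[cite: CartierCorvallis1979, §I.3] -/
theorem relIndex_cocycle {A B C : Subgroup G} (hAB : A.relIndex B ≠ 0) (hBA : B.relIndex A ≠ 0)
    (hBC : B.relIndex C ≠ 0) (hCB : C.relIndex B ≠ 0) (hCA : C.relIndex A ≠ 0) (hAC : A.relIndex C ≠ 0) :
    B.relIndex A * C.relIndex B * A.relIndex C = A.relIndex B * B.relIndex C * C.relIndex A := by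
  have h₁ := relIndex_inf_inf_mul_relIndex A B C
  have h₂ := relIndex_inf_inf_mul_relIndex B C A
  have h₃ := relIndex_inf_inf_mul_relIndex C A B
  have e₂ : B ⊓ C ⊓ A = A ⊓ B ⊓ C := by rw [inf_comm, inf_assoc]
  have e₃ : C ⊓ A ⊓ B = A ⊓ B ⊓ C := by rw [inf_assoc, inf_comm]
  rw [e₂] at h₂
  rw [e₃] at h₃
  have nA : (A ⊓ B ⊓ C).relIndex A ≠ 0 := relIndex_inf_inf_ne_zero hBA hCA
  have nB : (A ⊓ B ⊓ C).relIndex B ≠ 0 := by rw [← e₂]; exact relIndex_inf_inf_ne_zero hCB hAB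
  have nC : (A ⊓ B ⊓ C).relIndex C ≠ 0 := by rw [← e₃]; exact relIndex_inf_inf_ne_zero hAC hBC
  have key : ((A ⊓ B ⊓ C).relIndex A * (A ⊓ B ⊓ C).relIndex B * (A ⊓ B ⊓ C).relIndex C) *
      (B.relIndex A * C.relIndex B * A.relIndex C) =
      ((A ⊓ B ⊓ C).relIndex A * (A ⊓ B ⊓ C).relIndex B * (A ⊓ B ⊓ C).relIndex C) *
      (A.relIndex B * B.relIndex C * C.relIndex A) := by
    calc ((A ⊓ B ⊓ C).relIndex A * (A ⊓ B ⊓ C).relIndex B * (A ⊓ B ⊓ C).relIndex C) *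
          (B.relIndex A * C.relIndex B * A.relIndex C)
        = ((A ⊓ B ⊓ C).relIndex B * B.relIndex A) * ((A ⊓ B ⊓ C).relIndex C * C.relIndex B) *
          ((A ⊓ B ⊓ C).relIndex A * A.relIndex C) := by ring
      _ = ((A ⊓ B ⊓ C).relIndex A * A.relIndex B) * ((A ⊓ B ⊓ C).relIndex B * B.relIndex C) *
          ((A ⊓ B ⊓ C).relIndex C * C.relIndex A) := by rw [h₁, h₂, h₃]
      _ = _ := by ring
  exact mul_left_cancel₀ (mul_ne_zero (mul_ne_zero nA nB) nC) key

/-- The cocycle when one pair is balanced: if `[B : B ∩ C] = [C : B ∩ C]` then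
`[A : A ∩ B] · [C : C ∩ A] = [B : A ∩ B] · [A : C ∩ A]`. [cite: CartierCorvallis1979, §I.3] -/
theorem relIndex_mul_relIndex_eq_of_relIndex_comm {A B C : Subgroup G} (hAB : A.relIndex B ≠ 0) (hBA : B.relIndex A ≠ 0)
    (hBC : B.relIndex C ≠ 0) (hCB : C.relIndex B ≠ 0) (hCA : C.relIndex A ≠ 0) (hAC : A.relIndex C ≠ 0)
    (hcomm : C.relIndex B = B.relIndex C) :
    B.relIndex A * A.relIndex C = A.relIndex B * C.relIndex A := by
  have h := relIndex_cocycle hAB hBA hBC hCB hCA hAC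
  rw [hcomm, mul_right_comm (B.relIndex A), mul_right_comm (A.relIndex B)] at h
  exact mul_right_cancel₀ hBC h

/-! ## §2 Orbits of a subgroup on `G ⧸ K` -/

/-- The stabilizer in `L ≤ G` of the coset `pK` is `L ∩ pKp⁻¹`. [cite: CartierCorvallis1979, §I.3] -/
theorem stabilizer_subgroup_mk (L K : Subgroup G) (p : G) :
    stabilizer L (p : G ⧸ K) = (toConjAct p • K).subgroupOf L := by
  ext x
  rw [mem_stabilizer_iff, Subgroup.mem_subgroupOf, Subgroup.mem_pointwise_smul_iff_inv_smul_mem, ← toConjAct_inv,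
    toConjAct_inv_smul]
  change (((x : G) * p : G) : G ⧸ K) = (p : G ⧸ K) ↔ _
  rw [QuotientGroup.eq]
  have : (((x : G) * p)⁻¹ * p) = (p⁻¹ * (x : G) * p)⁻¹ := by group
  rw [this, Subgroup.inv_mem_iff]

/-- **Orbit–stabilizer for `L` acting on `G ⧸ K`**: `#(L · pK) = [L : L ∩ pKp⁻¹]` (as `Set.ncard`; both sides `0` when
infinite). [cite: CartierCorvallis1979, §I.3] -/
theorem ncard_orbit_subgroup_mk (L K : Subgroup G) (p : G) :
    (orbit L (p : G ⧸ K)).ncard = (toConjAct p • K).relIndex L := by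
  rw [← index_stabilizer, stabilizer_subgroup_mk]
  rfl

namespace IsIwasawaExponent

variable {Λ : Type*} [AddCommGroup Λ] {R : Type*} [CommRing R] {P K : Subgroup G} {a : G → Λ}

/-! ## §3 Finiteness and conjugates of `K_P = P ∩ K` -/

/-- For a Hecke pair, `[L : L ∩ gKg⁻¹] ≠ 0` for every `L ≤ K` (the orbit `K · gK` is finite).
[cite: CartierCorvallis1979, §I.3] -/
theorem relIndex_conjAct_smul_ne_zero [IsHeckeTriple (⊤ : Submonoid G) K K] (g : G) {L : Subgroup G} (hL : L ≤ K) :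
    (toConjAct g • K).relIndex L ≠ 0 := by
  intro h0
  have hK : (toConjAct g • K).relIndex K = 0 := Subgroup.relIndex_eq_zero_of_le_right hL h0
  rw [← ncard_orbit_subgroup_mk] at hK
  have hpos : 0 < (orbit K (g : G ⧸ K)).ncard :=
    (Set.ncard_pos (finite_orbit_quotient K g)).2 ⟨_, mem_orbit_self _⟩
  omega

/-- `p K_P p⁻¹ = P ∩ pKp⁻¹` for `p ∈ P`. [cite: CartierCorvallis1979, §IV (4.2)] -/
theorem smul_inf_eq_of_mem {p : G} (hp : p ∈ P) : toConjAct p • (P ⊓ K) = P ⊓ toConjAct p • K := by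
  rw [Subgroup.smul_inf, Subgroup.conjAct_pointwise_smul_eq_self (Subgroup.le_normalizer hp)]

/-- `[K_P : K_P ∩ pKp⁻¹] = [K_P : K_P ∩ pK_Pp⁻¹]` for `p ∈ P`. [cite: CartierCorvallis1979, §IV (4.2)] -/
theorem relIndex_conj_eq_of_mem {p : G} (hp : p ∈ P) :
    (toConjAct p • K).relIndex (P ⊓ K) = (toConjAct p • (P ⊓ K)).relIndex (P ⊓ K) := by
  rw [← Subgroup.inf_relIndex_right (toConjAct p • K), ← Subgroup.inf_relIndex_right (toConjAct p • (P ⊓ K)),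
    smul_inf_eq_of_mem hp]
  congr 1
  exact le_antisymm (le_inf (le_inf (inf_le_right.trans inf_le_left) inf_le_left) inf_le_right)
    (le_inf (inf_le_left.trans inf_le_right) inf_le_right)

/-- The conjugates `pK_Pp⁻¹`, `tK_Pt⁻¹` (`p, t ∈ P`) of `K_P` are pairwise commensurable: `[tK_Pt⁻¹ : tK_Pt⁻¹ ∩ pK_Pp⁻¹] ≠ 0`.
[cite: CartierCorvallis1979, §I.3] -/
theorem relIndex_conj_conj_ne_zero [IsHeckeTriple (⊤ : Submonoid G) K K] {p t : G} (hp : p ∈ P) (ht : t ∈ P) :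
    (toConjAct p • (P ⊓ K)).relIndex (toConjAct t • (P ⊓ K)) ≠ 0 := by
  have h1 : toConjAct p • (P ⊓ K) = toConjAct t • (toConjAct (t⁻¹ * p) • (P ⊓ K)) := by
    rw [smul_smul, ← toConjAct_mul, mul_inv_cancel_left]
  rw [h1, Subgroup.relIndex_pointwise_smul, ← relIndex_conj_eq_of_mem (P.mul_mem (P.inv_mem ht) hp)]
  exact relIndex_conjAct_smul_ne_zero _ inf_le_right

/-- `[K_P : K_P ∩ pK_Pp⁻¹] ≠ 0` for `p ∈ P`. [cite: CartierCorvallis1979, §I.3] -/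
theorem relIndex_conj_ne_zero [IsHeckeTriple (⊤ : Submonoid G) K K] {p : G} (hp : p ∈ P) :
    (toConjAct p • (P ⊓ K)).relIndex (P ⊓ K) ≠ 0 := by
  simpa using relIndex_conj_conj_ne_zero (K := K) hp P.one_mem

/-- `[pK_Pp⁻¹ : K_P ∩ pK_Pp⁻¹] ≠ 0` for `p ∈ P`. [cite: CartierCorvallis1979, §I.3] -/
theorem relIndex_conj_ne_zero' [IsHeckeTriple (⊤ : Submonoid G) K K] {p : G} (hp : p ∈ P) :
    (P ⊓ K).relIndex (toConjAct p • (P ⊓ K)) ≠ 0 := by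
  simpa using relIndex_conj_conj_ne_zero (K := K) P.one_mem hp

/-! ## §4 The finite sets `{γ ∈ KgK/K : a γ = μ}` -/

omit [AddCommGroup Λ] in
/-- Membership in `{γ ∈ KgK/K : a γ = μ}`. [cite: CartierCorvallis1979, §IV (4.2)] -/
theorem mem_filter_orbit_iff [IsHeckeTriple (⊤ : Submonoid G) K K] (g : G) (μ : Λ)
    [DecidablePred fun α : G ⧸ K => a α.out = μ] (γ : G ⧸ K) :
    γ ∈ (finite_orbit_quotient K g).toFinset.filter (fun α => a α.out = μ) ↔ γ ∈ orbit K (g : G ⧸ K) ∧ a γ.out = μ := by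
  rw [Finset.mem_filter, Set.Finite.mem_toFinset]

/-- `K_P` preserves exponents: `a(k γ) = a(γ)` for `k ∈ P ∩ K`. [cite: CartierCorvallis1979, §IV (4.2)] -/
theorem apply_out_smul_of_mem_inf (h : IsIwasawaExponent P K a) {k : G} (hk : k ∈ P ⊓ K) (γ : G ⧸ K) :
    a (k • γ).out = a γ.out := by
  have hγ : ((k * γ.out : G) : G ⧸ K) = k • γ := by
    rw [← MulAction.Quotient.coe_smul_out, smul_eq_mul]
  rw [h.apply_out_eq_of_mk_eq hγ, h.mul_of_mem_left (Subgroup.mem_inf.1 hk).1,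
    h.eq_zero_of_mem_right (Subgroup.mem_inf.1 hk).2, zero_add]

/-- `{γ ∈ KgK/K : a γ = μ}` is stable under `K_P = P ∩ K`. [cite: CartierCorvallis1979, §IV (4.2)] -/
theorem smul_mem_filter_orbit (h : IsIwasawaExponent P K a) [IsHeckeTriple (⊤ : Submonoid G) K K] (g : G) (μ : Λ)
    [DecidablePred fun α : G ⧸ K => a α.out = μ]
    (k : ↥(P ⊓ K)) {γ : G ⧸ K} (hγ : γ ∈ (finite_orbit_quotient K g).toFinset.filter (fun α => a α.out = μ)) :
    k • γ ∈ (finite_orbit_quotient K g).toFinset.filter (fun α => a α.out = μ) := by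
  rw [mem_filter_orbit_iff] at hγ ⊢
  refine ⟨?_, ?_⟩
  · have : k • γ = (⟨(k : G), (Subgroup.mem_inf.1 k.2).2⟩ : K) • γ := rfl
    rw [this]
    exact mem_orbit_of_mem_orbit _ hγ.1
  · change a ((k : G) • γ).out = μ
    rw [h.apply_out_smul_of_mem_inf k.2, hγ.2]

/-- The `K_P`-orbit of a member of `{γ ∈ KgK/K : a γ = μ}` stays inside. [cite: CartierCorvallis1979, §IV (4.2)] -/
theorem orbit_subset_filter_orbit (h : IsIwasawaExponent P K a) [IsHeckeTriple (⊤ : Submonoid G) K K] (g : G) (μ : Λ)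
    [DecidablePred fun α : G ⧸ K => a α.out = μ]
    {γ : G ⧸ K} (hγ : γ ∈ (finite_orbit_quotient K g).toFinset.filter (fun α => a α.out = μ)) :
    orbit (↥(P ⊓ K)) γ ⊆ ↑((finite_orbit_quotient K g).toFinset.filter (fun α => a α.out = μ)) := by
  rintro _ ⟨k, rfl⟩
  exact h.smul_mem_filter_orbit g μ k hγ

/-- `K_P`-orbits in `G ⧸ K` are finite for a Hecke pair (they lie in `K`-orbits). [cite: CartierCorvallis1979, §I.3] -/
theorem finite_orbit_inf [IsHeckeTriple (⊤ : Submonoid G) K K] (γ : G ⧸ K) : (orbit (↥(P ⊓ K)) γ).Finite := by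
  refine (finite_orbit_quotient K γ.out).subset ?_
  rintro _ ⟨k, rfl⟩
  rw [QuotientGroup.out_eq']
  exact mem_orbit_iff.2 ⟨⟨(k : G), (Subgroup.mem_inf.1 k.2).2⟩, rfl⟩

/-- A `P`-SECTION of `G → G ⧸ K` exists: `γ = p_γ K` with `p_γ ∈ P` (Iwasawa decomposition). [cite: CartierCorvallis1979, §IV (4.2)] -/
theorem exists_section (h : IsIwasawaExponent P K a) : ∃ s : G ⧸ K → G, (∀ γ, s γ ∈ P) ∧ ∀ γ, (s γ : G ⧸ K) = γ := by
  refine ⟨fun γ => (h.exists_out_eq_mul γ).choose, fun γ => (h.exists_out_eq_mul γ).choose_spec.1, fun γ => ?_⟩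
  obtain ⟨-, k, hk, hγ, -⟩ := (h.exists_out_eq_mul γ).choose_spec
  show (((h.exists_out_eq_mul γ).choose : G) : G ⧸ K) = γ
  conv_rhs => rw [← QuotientGroup.out_eq' γ, hγ]
  rw [QuotientGroup.eq, inv_mul_cancel_left]
  exact hk

section Section

variable {s : G ⧸ K → G}

/-- For a `P`-section, `a γ = a (s γ)`. [cite: CartierCorvallis1979, §IV (4.2)] -/
theorem apply_out_eq_apply_section (h : IsIwasawaExponent P K a) (hs : ∀ γ, (s γ : G ⧸ K) = γ) (γ : G ⧸ K) :
    a γ.out = a (s γ) :=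
  h.apply_out_eq_of_mk_eq (hs γ)

/-- Two `P`-representatives of cosets in one `K_P`-orbit generate the same `(K_P, K_P)`-double coset: if `γ = k • γ₀`
(`k ∈ K_P`) then `s γ₀ = k⁻¹ (s γ) k'` with `k' ∈ K_P`. [cite: CartierCorvallis1979, §IV (4.2)] -/
theorem doubleCoset_section_eq_of_mem_orbit (hsP : ∀ γ, s γ ∈ P) (hs : ∀ γ, (s γ : G ⧸ K) = γ) {γ₀ γ : G ⧸ K}
    (hγ : γ ∈ orbit (↥(P ⊓ K)) γ₀) :
    DoubleCoset.mk (P ⊓ K) (P ⊓ K) (s γ) = DoubleCoset.mk (P ⊓ K) (P ⊓ K) (s γ₀) := by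
  obtain ⟨k, rfl⟩ := mem_orbit_iff.1 hγ
  rw [DoubleCoset.eq]
  have hk : (s (k • γ₀))⁻¹ * ((k : G) * s γ₀) ∈ K := by
    rw [← QuotientGroup.eq, hs]
    change (k : G) • γ₀ = (((k : G) * s γ₀ : G) : G ⧸ K)
    conv_lhs => rw [← hs γ₀]
    rw [MulAction.Quotient.smul_coe, smul_eq_mul]
  refine ⟨(k : G)⁻¹, (P ⊓ K).inv_mem k.2, (s (k • γ₀))⁻¹ * ((k : G) * s γ₀), Subgroup.mem_inf.2 ⟨?_, hk⟩, by group⟩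
  exact P.mul_mem (P.inv_mem (hsP _)) (P.mul_mem (Subgroup.mem_inf.1 k.2).1 (hsP _))

/-- Conversely, equal `(K_P, K_P)`-double cosets of the representatives means one `K_P`-orbit.
[cite: CartierCorvallis1979, §IV (4.2)] -/
theorem mem_orbit_of_doubleCoset_section_eq (hs : ∀ γ, (s γ : G ⧸ K) = γ) {γ₀ γ : G ⧸ K}
    (hγ : DoubleCoset.mk (P ⊓ K) (P ⊓ K) (s γ) = DoubleCoset.mk (P ⊓ K) (P ⊓ K) (s γ₀)) :
    γ ∈ orbit (↥(P ⊓ K)) γ₀ := by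
  obtain ⟨b, hb, c, hc, hbc⟩ := (DoubleCoset.eq _ _ _ _).1 hγ
  rw [mem_orbit_symm]
  refine mem_orbit_iff.2 ⟨⟨b, hb⟩, ?_⟩
  change (b • γ : G ⧸ K) = γ₀
  rw [← hs γ, ← hs γ₀, MulAction.Quotient.smul_coe, smul_eq_mul, hbc, QuotientGroup.eq]
  simpa [mul_assoc] using (Subgroup.mem_inf.1 hc).2

/-- **The fibres of `γ ↦ K_P p_γ K_P` on `{γ ∈ KgK/K : a γ = μ}` are the `K_P`-orbits.** [cite: CartierCorvallis1979, §IV (4.2)] -/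
theorem filter_doubleCoset_eq_finite_toFinset (h : IsIwasawaExponent P K a) [IsHeckeTriple (⊤ : Submonoid G) K K]
    (hsP : ∀ γ, s γ ∈ P) (hs : ∀ γ, (s γ : G ⧸ K) = γ) (g : G) (μ : Λ)
    [DecidablePred fun α : G ⧸ K => a α.out = μ] [DecidableEq (DoubleCoset.Quotient (↑(P ⊓ K) : Set G) ↑(P ⊓ K))]
    {γ₀ : G ⧸ K} (hγ₀ : γ₀ ∈ (finite_orbit_quotient K g).toFinset.filter (fun α => a α.out = μ))
    (hfin : (orbit (↥(P ⊓ K)) γ₀).Finite) :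
    ((finite_orbit_quotient K g).toFinset.filter (fun α => a α.out = μ)).filter
        (fun γ => DoubleCoset.mk (P ⊓ K) (P ⊓ K) (s γ) = DoubleCoset.mk (P ⊓ K) (P ⊓ K) (s γ₀)) = hfin.toFinset := by
  ext γ
  rw [Finset.mem_filter, Set.Finite.mem_toFinset]
  constructor
  · rintro ⟨-, hγ⟩
    exact mem_orbit_of_doubleCoset_section_eq hs hγ
  · intro hγ
    exact ⟨h.orbit_subset_filter_orbit g μ hγ₀ hγ, doubleCoset_section_eq_of_mem_orbit hsP hs hγ⟩

/-- **The fibre over `K_P p_γ K_P` has `[K_P : K_P ∩ p_γ K_P p_γ⁻¹]` elements.** [cite: CartierCorvallis1979, §I.3] -/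
theorem card_filter_doubleCoset_eq_relIndex (h : IsIwasawaExponent P K a) [IsHeckeTriple (⊤ : Submonoid G) K K]
    (hsP : ∀ γ, s γ ∈ P) (hs : ∀ γ, (s γ : G ⧸ K) = γ) (g : G) (μ : Λ)
    [DecidablePred fun α : G ⧸ K => a α.out = μ] [DecidableEq (DoubleCoset.Quotient (↑(P ⊓ K) : Set G) ↑(P ⊓ K))]
    {γ₀ : G ⧸ K} (hγ₀ : γ₀ ∈ (finite_orbit_quotient K g).toFinset.filter (fun α => a α.out = μ)) :
    (((finite_orbit_quotient K g).toFinset.filter (fun α => a α.out = μ)).filter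
        (fun γ => DoubleCoset.mk (P ⊓ K) (P ⊓ K) (s γ) = DoubleCoset.mk (P ⊓ K) (P ⊓ K) (s γ₀))).card =
      (toConjAct (s γ₀) • (P ⊓ K)).relIndex (P ⊓ K) := by
  rw [h.filter_doubleCoset_eq_finite_toFinset hsP hs g μ hγ₀ (finite_orbit_inf γ₀),
    ← Set.ncard_eq_toFinset_card _ (finite_orbit_inf γ₀), ← relIndex_conj_eq_of_mem (hsP γ₀),
    ← ncard_orbit_subgroup_mk, hs]

/-- **Inversion**: if `γ₀ = p₀ K ⊆ KgK` has `a γ₀ = μ` (`p₀ ∈ P`), then `p₀⁻¹ K ⊆ Kg⁻¹K` has exponent `-μ`.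
[cite: CartierCorvallis1979, §IV (4.2)] -/
theorem inv_mem_filter_orbit (h : IsIwasawaExponent P K a) [IsHeckeTriple (⊤ : Submonoid G) K K]
    (hsP : ∀ γ, s γ ∈ P) (hs : ∀ γ, (s γ : G ⧸ K) = γ) (g : G) (μ : Λ)
    [DecidablePred fun α : G ⧸ K => a α.out = μ] [DecidablePred fun α : G ⧸ K => a α.out = -μ]
    {γ₀ : G ⧸ K} (hγ₀ : γ₀ ∈ (finite_orbit_quotient K g).toFinset.filter (fun α => a α.out = μ)) :
    (((s γ₀)⁻¹ : G) : G ⧸ K) ∈ (finite_orbit_quotient K g⁻¹).toFinset.filter (fun α => a α.out = -μ) := by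
  rw [mem_filter_orbit_iff] at hγ₀ ⊢
  obtain ⟨hγ₀, hμ⟩ := hγ₀
  rw [← hs γ₀, heckeAlgebra.coe_mem_orbit_coe_iff] at hγ₀
  obtain ⟨b, hb, c, hc, hbc⟩ := hγ₀
  refine ⟨(heckeAlgebra.coe_mem_orbit_coe_iff K _ _).2 ⟨c⁻¹, K.inv_mem hc, b⁻¹, K.inv_mem hb, by rw [hbc]; group⟩, ?_⟩
  rw [h.apply_out_coe, h.apply_inv_of_mem_left (hsP γ₀), ← h.apply_out_eq_apply_section hs, hμ]

/-- The representative of `p₀⁻¹K` is `p₀⁻¹ k` with `k ∈ K_P`; hence `K_P (p_{p₀⁻¹K})⁻¹ K_P = K_P p₀ K_P`.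
[cite: CartierCorvallis1979, §IV (4.2)] -/
theorem doubleCoset_section_inv (hsP : ∀ γ, s γ ∈ P) (hs : ∀ γ, (s γ : G ⧸ K) = γ) (γ₀ : G ⧸ K) :
    DoubleCoset.mk (P ⊓ K) (P ⊓ K) (s (((s γ₀)⁻¹ : G) : G ⧸ K))⁻¹ = DoubleCoset.mk (P ⊓ K) (P ⊓ K) (s γ₀) := by
  have hk : (((s γ₀)⁻¹ : G) : G ⧸ K) = (s (((s γ₀)⁻¹ : G) : G ⧸ K) : G ⧸ K) := (hs _).symm
  rw [QuotientGroup.eq, inv_inv] at hk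
  rw [DoubleCoset.eq]
  exact ⟨(s γ₀) * s (((s γ₀)⁻¹ : G) : G ⧸ K), Subgroup.mem_inf.2 ⟨P.mul_mem (hsP _) (hsP _), hk⟩, 1,
    (P ⊓ K).one_mem, by group⟩

/-- The conjugate of `K_P` by the representative of `p₀⁻¹K` is `p₀⁻¹ K_P p₀`. [cite: CartierCorvallis1979, §IV (4.2)] -/
theorem conj_section_inv (hsP : ∀ γ, s γ ∈ P) (hs : ∀ γ, (s γ : G ⧸ K) = γ) (γ₀ : G ⧸ K) :
    toConjAct (s (((s γ₀)⁻¹ : G) : G ⧸ K)) • (P ⊓ K) = toConjAct (s γ₀)⁻¹ • (P ⊓ K) := by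
  have hk : (((s γ₀)⁻¹ : G) : G ⧸ K) = (s (((s γ₀)⁻¹ : G) : G ⧸ K) : G ⧸ K) := (hs _).symm
  rw [QuotientGroup.eq, inv_inv] at hk
  have hmem : (s γ₀) * s (((s γ₀)⁻¹ : G) : G ⧸ K) ∈ P ⊓ K := Subgroup.mem_inf.2 ⟨P.mul_mem (hsP _) (hsP _), hk⟩
  have e : s (((s γ₀)⁻¹ : G) : G ⧸ K) = (s γ₀)⁻¹ * ((s γ₀) * s (((s γ₀)⁻¹ : G) : G ⧸ K)) := by group
  rw [e, toConjAct_mul, mul_smul, Subgroup.conjAct_pointwise_smul_eq_self (Subgroup.le_normalizer hmem)]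

/-- **The images of `{γ ∈ KgK/K : a γ = μ}` under `γ ↦ K_P p_γ K_P` and of `{γ' ∈ Kg⁻¹K/K : a γ' = -μ}` under
`γ' ↦ K_P p_{γ'}⁻¹ K_P` coincide** (`K_P p K_P ↔ K_P p⁻¹ K_P`). [cite: CartierCorvallis1979, §IV (4.2)] -/
theorem image_doubleCoset_eq (h : IsIwasawaExponent P K a) [IsHeckeTriple (⊤ : Submonoid G) K K]
    (hsP : ∀ γ, s γ ∈ P) (hs : ∀ γ, (s γ : G ⧸ K) = γ) (g : G) (μ : Λ)
    [DecidablePred fun α : G ⧸ K => a α.out = μ] [DecidablePred fun α : G ⧸ K => a α.out = -μ]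
    [DecidableEq (DoubleCoset.Quotient (↑(P ⊓ K) : Set G) ↑(P ⊓ K))] :
    ((finite_orbit_quotient K g).toFinset.filter (fun α => a α.out = μ)).image
        (fun γ => DoubleCoset.mk (P ⊓ K) (P ⊓ K) (s γ)) =
      ((finite_orbit_quotient K g⁻¹).toFinset.filter (fun α => a α.out = -μ)).image
        (fun γ => DoubleCoset.mk (P ⊓ K) (P ⊓ K) (s γ)⁻¹) := by
  classical
  ext D
  simp only [Finset.mem_image]
  constructor
  · rintro ⟨γ₀, hγ₀, rfl⟩
    exact ⟨_, h.inv_mem_filter_orbit hsP hs g μ hγ₀, doubleCoset_section_inv hsP hs γ₀⟩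
  · rintro ⟨γ₁, hγ₁, rfl⟩
    have hγ₁' := h.inv_mem_filter_orbit hsP hs g⁻¹ (-μ) hγ₁
    rw [inv_inv] at hγ₁'
    have e : ((finite_orbit_quotient K g).toFinset.filter fun α => a α.out = -(-μ)) =
        ((finite_orbit_quotient K g).toFinset.filter fun α => a α.out = μ) := by
      ext α
      rw [mem_filter_orbit_iff, mem_filter_orbit_iff, neg_neg]
    rw [e] at hγ₁'
    refine ⟨_, hγ₁', ?_⟩
    have h2 := doubleCoset_section_inv (P := P) (K := K) hsP hs γ₁
    rw [DoubleCoset.eq] at h2 ⊢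
    obtain ⟨b, hb, c, hc, hbc⟩ := h2
    refine ⟨c⁻¹, (P ⊓ K).inv_mem hc, b⁻¹, (P ⊓ K).inv_mem hb, ?_⟩
    conv_lhs => rw [hbc]
    group

end Section

/-! ## §5 The duality in `ℕ` -/

/-- Left cosets of `KgK` with an exponent outside `a(P)` do not exist. [cite: CartierCorvallis1979, §IV (4.2)] -/
theorem card_filter_eq_zero_of_forall_ne (h : IsIwasawaExponent P K a) [IsHeckeTriple (⊤ : Submonoid G) K K] (g : G)
    {μ : Λ} [DecidablePred fun α : G ⧸ K => a α.out = μ] (hμ : ∀ p ∈ P, a p ≠ μ) :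
    ((finite_orbit_quotient K g).toFinset.filter (fun α => a α.out = μ)).card = 0 := by
  rw [Finset.card_eq_zero, Finset.filter_eq_empty_iff]
  intro γ _ hγ
  obtain ⟨p, hp, k, -, -, hap⟩ := h.exists_out_eq_mul γ
  exact hμ p hp (hap ▸ hγ)

/-- **DUALITY OF THE COUNTING TRANSFORM** (Cartier §IV (4.2) with §I.3; Laumon (4.1.4)–(4.1.6)).  Let `a` be an Iwasawa
exponent for `(P, K)`, `(G, K)` a Hecke pair, `K_P = P ∩ K`, and suppose every `y ∈ P` with `a y = 0` lies in a subgroup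
`V ⊇ K_P` with `[V : K_P] < ∞` (relative unimodularity of `P ∩ a⁻¹(0)`).  Then for every `g ∈ G` and `t ∈ P`,
`#{γ ∈ KgK/K : a γ = a t} · [tK_Pt⁻¹ : K_P ∩ tK_Pt⁻¹] = #{γ ∈ Kg⁻¹K/K : a γ = -a t} · [K_P : K_P ∩ tK_Pt⁻¹]`:
the number of left cosets of `KgK` with exponent `μ` is `δ(μ)` times the number of left cosets of `Kg⁻¹K` with exponent `-μ`,
`δ(μ) = [K_P : K_P ∩ tK_Pt⁻¹]/[tK_Pt⁻¹ : K_P ∩ tK_Pt⁻¹]` the modulus of `P`.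
[cite: CartierCorvallis1979, §IV (4.2)] [cite: Laumon1995, (4.1.4)–(4.1.6)] -/
theorem card_filter_mul_relIndex_eq (h : IsIwasawaExponent P K a) [IsHeckeTriple (⊤ : Submonoid G) K K]
    (hU : ∀ y ∈ P, a y = 0 → ∃ V : Subgroup G, y ∈ V ∧ P ⊓ K ≤ V ∧ (P ⊓ K).relIndex V ≠ 0)
    (g : G) {t : G} (ht : t ∈ P) [DecidablePred fun α : G ⧸ K => a α.out = a t]
    [DecidablePred fun α : G ⧸ K => a α.out = -a t] :
    ((finite_orbit_quotient K g).toFinset.filter (fun α => a α.out = a t)).card *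
        (P ⊓ K).relIndex (toConjAct t • (P ⊓ K)) =
      ((finite_orbit_quotient K g⁻¹).toFinset.filter (fun α => a α.out = -a t)).card *
        (toConjAct t • (P ⊓ K)).relIndex (P ⊓ K) := by
  classical
  obtain ⟨s, hsP, hs⟩ := h.exists_section
  rw [Finset.card_eq_sum_card_image (fun γ => DoubleCoset.mk (P ⊓ K) (P ⊓ K) (s γ))
      ((finite_orbit_quotient K g).toFinset.filter (fun α => a α.out = a t)),
    Finset.card_eq_sum_card_image (fun γ => DoubleCoset.mk (P ⊓ K) (P ⊓ K) (s γ)⁻¹)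
      ((finite_orbit_quotient K g⁻¹).toFinset.filter (fun α => a α.out = -a t)),
    Finset.sum_mul, Finset.sum_mul, ← h.image_doubleCoset_eq hsP hs g (a t)]
  refine Finset.sum_congr rfl fun D hD => ?_
  obtain ⟨γ₀, hγ₀, rfl⟩ := Finset.mem_image.1 hD
  -- the fibre of `γ ↦ K_P p_γ K_P` over `K_P p₀ K_P` (`p₀ = s γ₀`) is the `K_P`-orbit of `γ₀`
  have hfib₁ : (((finite_orbit_quotient K g).toFinset.filter (fun α => a α.out = a t)).filter
      (fun γ => DoubleCoset.mk (P ⊓ K) (P ⊓ K) (s γ) = DoubleCoset.mk (P ⊓ K) (P ⊓ K) (s γ₀))).card =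
      (toConjAct (s γ₀) • (P ⊓ K)).relIndex (P ⊓ K) :=
    h.card_filter_doubleCoset_eq_relIndex hsP hs g (a t) hγ₀
  -- the fibre of `γ' ↦ K_P p_{γ'}⁻¹ K_P` over `K_P p₀ K_P` is the `K_P`-orbit of `p₀⁻¹ K`
  have hγ₁ := h.inv_mem_filter_orbit hsP hs g (a t) hγ₀
  have hfib₂ : (((finite_orbit_quotient K g⁻¹).toFinset.filter (fun α => a α.out = -a t)).filter
      (fun γ => DoubleCoset.mk (P ⊓ K) (P ⊓ K) (s γ)⁻¹ = DoubleCoset.mk (P ⊓ K) (P ⊓ K) (s γ₀))).card =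
      (P ⊓ K).relIndex (toConjAct (s γ₀) • (P ⊓ K)) := by
    have hcongr : (((finite_orbit_quotient K g⁻¹).toFinset.filter (fun α => a α.out = -a t)).filter
        (fun γ => DoubleCoset.mk (P ⊓ K) (P ⊓ K) (s γ)⁻¹ = DoubleCoset.mk (P ⊓ K) (P ⊓ K) (s γ₀))) =
        ((finite_orbit_quotient K g⁻¹).toFinset.filter (fun α => a α.out = -a t)).filter
          (fun γ => DoubleCoset.mk (P ⊓ K) (P ⊓ K) (s γ) =
            DoubleCoset.mk (P ⊓ K) (P ⊓ K) (s (((s γ₀)⁻¹ : G) : G ⧸ K))) := by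
      refine Finset.filter_congr fun γ _ => ?_
      rw [← doubleCoset_section_inv hsP hs γ₀, DoubleCoset.eq, DoubleCoset.eq]
      constructor
      · rintro ⟨b, hb, c, hc, hbc⟩
        refine ⟨c⁻¹, (P ⊓ K).inv_mem hc, b⁻¹, (P ⊓ K).inv_mem hb, ?_⟩
        rw [← inv_inv (s (((s γ₀)⁻¹ : G) : G ⧸ K)), hbc]
        group
      · rintro ⟨b, hb, c, hc, hbc⟩
        refine ⟨c⁻¹, (P ⊓ K).inv_mem hc, b⁻¹, (P ⊓ K).inv_mem hb, ?_⟩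
        rw [hbc]
        group
    rw [hcongr, h.card_filter_doubleCoset_eq_relIndex hsP hs g⁻¹ (-a t) hγ₁, conj_section_inv hsP hs γ₀]
    conv_rhs => rw [← Subgroup.relIndex_pointwise_smul (toConjAct (s γ₀))⁻¹ (P ⊓ K) (toConjAct (s γ₀) • (P ⊓ K)),
      inv_smul_smul, ← toConjAct_inv]
  rw [hfib₁, hfib₂]
  -- an identity of indices: `[A : A ∩ B] [C : C ∩ A] = [B : A ∩ B] [A : C ∩ A]`, `A = K_P`, `B = p₀K_Pp₀⁻¹`, `C = tK_Pt⁻¹`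
  have hp₀P : s γ₀ ∈ P := hsP γ₀
  have hap₀ : a (s γ₀) = a t := by
    rw [← h.apply_out_eq_apply_section hs]
    exact ((mem_filter_orbit_iff g (a t) γ₀).1 hγ₀).2
  -- relative unimodularity: `[B : B ∩ C] = [C : B ∩ C]` since `B = x C x⁻¹` with `x = p₀ t⁻¹ ∈ t V t⁻¹`
  obtain ⟨V, hyV, hKV, hVfin⟩ := hU (t⁻¹ * s γ₀) (P.mul_mem (P.inv_mem ht) hp₀P)
    (by rw [h.mul_of_mem_left (P.inv_mem ht), h.apply_inv_of_mem_left ht, hap₀, neg_add_cancel])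
  have hcomm : (toConjAct t • (P ⊓ K)).relIndex (toConjAct (s γ₀) • (P ⊓ K)) =
      (toConjAct (s γ₀) • (P ⊓ K)).relIndex (toConjAct t • (P ⊓ K)) := by
    have hx : s γ₀ * t⁻¹ ∈ toConjAct t • V := by
      rw [Subgroup.mem_pointwise_smul_iff_inv_smul_mem, ← toConjAct_inv, toConjAct_inv_smul]
      simpa [mul_assoc] using hyV
    have hCV : toConjAct t • (P ⊓ K) ≤ toConjAct t • V := Subgroup.pointwise_smul_le_pointwise_smul_iff.2 hKV
    have hfin : (toConjAct t • (P ⊓ K)).relIndex (toConjAct t • V) ≠ 0 := by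
      rwa [Subgroup.relIndex_pointwise_smul]
    have key := relIndex_conjAct_smul_comm_of_mem hx hCV hfin
    rw [smul_smul, ← toConjAct_mul, inv_mul_cancel_right] at key
    exact key.symm
  exact relIndex_mul_relIndex_eq_of_relIndex_comm (relIndex_conj_ne_zero' hp₀P) (relIndex_conj_ne_zero hp₀P)
    (relIndex_conj_conj_ne_zero hp₀P ht) (relIndex_conj_conj_ne_zero ht hp₀P) (relIndex_conj_ne_zero ht)
    (relIndex_conj_ne_zero' ht) hcomm

/-- **The index ratio is multiplicative** (the modulus is a character of `P`; no unimodularity needed):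
`[K_P : K_P ∩ tt'K_P(tt')⁻¹] · [tK_Pt⁻¹ : K_P ∩ tK_Pt⁻¹] · [t'K_Pt'⁻¹ : K_P ∩ t'K_Pt'⁻¹] =
 [tt'K_P(tt')⁻¹ : K_P ∩ tt'K_P(tt')⁻¹] · [K_P : K_P ∩ tK_Pt⁻¹] · [K_P : K_P ∩ t'K_Pt'⁻¹]` (`t, t' ∈ P`).
[cite: CartierCorvallis1979, §I.3] -/
theorem relIndex_conj_mul_conj [IsHeckeTriple (⊤ : Submonoid G) K K] {t t' : G} (ht : t ∈ P) (ht' : t' ∈ P) :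
    (toConjAct (t * t') • (P ⊓ K)).relIndex (P ⊓ K) * (P ⊓ K).relIndex (toConjAct t • (P ⊓ K)) *
        (P ⊓ K).relIndex (toConjAct t' • (P ⊓ K)) =
      (P ⊓ K).relIndex (toConjAct (t * t') • (P ⊓ K)) * (toConjAct t • (P ⊓ K)).relIndex (P ⊓ K) *
        (toConjAct t' • (P ⊓ K)).relIndex (P ⊓ K) := by
  -- cocycle for `A = K_P`, `B = tK_Pt⁻¹`, `C = tt'K_P(tt')⁻¹`, and `[B : B ∩ C] = [K_P : K_P ∩ t'K_Pt'⁻¹]` etc. by conjugation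
  have htt' : t * t' ∈ P := P.mul_mem ht ht'
  have hcoc := relIndex_cocycle (A := P ⊓ K) (B := toConjAct t • (P ⊓ K)) (C := toConjAct (t * t') • (P ⊓ K))
    (relIndex_conj_ne_zero' ht) (relIndex_conj_ne_zero ht)
    (relIndex_conj_conj_ne_zero ht htt') (relIndex_conj_conj_ne_zero htt' ht)
    (relIndex_conj_ne_zero htt') (relIndex_conj_ne_zero' htt')
  have e1 : (toConjAct (t * t') • (P ⊓ K)).relIndex (toConjAct t • (P ⊓ K)) =
      (toConjAct t' • (P ⊓ K)).relIndex (P ⊓ K) := by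
    conv_lhs => rw [toConjAct_mul, mul_smul, ← Subgroup.relIndex_pointwise_smul (toConjAct t)⁻¹, inv_smul_smul,
      inv_smul_smul]
  have e2 : (toConjAct t • (P ⊓ K)).relIndex (toConjAct (t * t') • (P ⊓ K)) =
      (P ⊓ K).relIndex (toConjAct t' • (P ⊓ K)) := by
    conv_lhs => rw [toConjAct_mul, mul_smul, ← Subgroup.relIndex_pointwise_smul (toConjAct t)⁻¹, inv_smul_smul,
      inv_smul_smul]
  rw [e1, e2] at hcoc
  -- hcoc : [t.A] * [t'.A] * [A.(tt')] = [A.t] * [A.t'] * [(tt').A]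
  calc (toConjAct (t * t') • (P ⊓ K)).relIndex (P ⊓ K) * (P ⊓ K).relIndex (toConjAct t • (P ⊓ K)) *
        (P ⊓ K).relIndex (toConjAct t' • (P ⊓ K))
      = (P ⊓ K).relIndex (toConjAct t • (P ⊓ K)) * (P ⊓ K).relIndex (toConjAct t' • (P ⊓ K)) *
        (toConjAct (t * t') • (P ⊓ K)).relIndex (P ⊓ K) := by ring
    _ = (toConjAct t • (P ⊓ K)).relIndex (P ⊓ K) * (toConjAct t' • (P ⊓ K)).relIndex (P ⊓ K) *
        (P ⊓ K).relIndex (toConjAct (t * t') • (P ⊓ K)) := hcoc.symm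
    _ = _ := by ring

/-- **The index ratio depends only on `a t`** (under the relative unimodularity of `P ∩ a⁻¹(0)`): if `a t = a t'` then
`[K_P : K_P ∩ tK_Pt⁻¹] · [t'K_Pt'⁻¹ : K_P ∩ t'K_Pt'⁻¹] = [K_P : K_P ∩ t'K_Pt'⁻¹] · [tK_Pt⁻¹ : K_P ∩ tK_Pt⁻¹]`.
[cite: CartierCorvallis1979, §I.3] -/
theorem relIndex_conj_eq_of_apply_eq (h : IsIwasawaExponent P K a) [IsHeckeTriple (⊤ : Submonoid G) K K]
    (hU : ∀ y ∈ P, a y = 0 → ∃ V : Subgroup G, y ∈ V ∧ P ⊓ K ≤ V ∧ (P ⊓ K).relIndex V ≠ 0)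
    {t t' : G} (ht : t ∈ P) (ht' : t' ∈ P) (htt' : a t = a t') :
    (toConjAct t • (P ⊓ K)).relIndex (P ⊓ K) * (P ⊓ K).relIndex (toConjAct t' • (P ⊓ K)) =
      (toConjAct t' • (P ⊓ K)).relIndex (P ⊓ K) * (P ⊓ K).relIndex (toConjAct t • (P ⊓ K)) := by
  -- `t' t⁻¹ ∈ t V t⁻¹` with `t⁻¹ t' ∈ V` from the hypothesis, so `[tK_P : tK_P ∩ t'K_P] = [t'K_P : tK_P ∩ t'K_P]`
  obtain ⟨V, hyV, hKV, hVfin⟩ := hU (t⁻¹ * t') (P.mul_mem (P.inv_mem ht) ht')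
    (by rw [h.mul_of_mem_left (P.inv_mem ht), h.apply_inv_of_mem_left ht, htt', neg_add_cancel])
  have hcomm : (toConjAct t • (P ⊓ K)).relIndex (toConjAct t' • (P ⊓ K)) =
      (toConjAct t' • (P ⊓ K)).relIndex (toConjAct t • (P ⊓ K)) := by
    have hx : t' * t⁻¹ ∈ toConjAct t • V := by
      rw [Subgroup.mem_pointwise_smul_iff_inv_smul_mem, ← toConjAct_inv, toConjAct_inv_smul]
      simpa [mul_assoc] using hyV
    have hCV : toConjAct t • (P ⊓ K) ≤ toConjAct t • V := Subgroup.pointwise_smul_le_pointwise_smul_iff.2 hKV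
    have hfin : (toConjAct t • (P ⊓ K)).relIndex (toConjAct t • V) ≠ 0 := by
      rwa [Subgroup.relIndex_pointwise_smul]
    have key := relIndex_conjAct_smul_comm_of_mem hx hCV hfin
    rw [smul_smul, ← toConjAct_mul, inv_mul_cancel_right] at key
    exact key.symm
  have hmain := relIndex_mul_relIndex_eq_of_relIndex_comm (relIndex_conj_ne_zero' ht') (relIndex_conj_ne_zero ht')
    (relIndex_conj_conj_ne_zero ht' ht) (relIndex_conj_conj_ne_zero ht ht') (relIndex_conj_ne_zero ht)
    (relIndex_conj_ne_zero' ht) hcomm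
  -- hmain : [t'.A] * [A.t] = [A.t'] * [t.A]
  calc (toConjAct t • (P ⊓ K)).relIndex (P ⊓ K) * (P ⊓ K).relIndex (toConjAct t' • (P ⊓ K))
      = (P ⊓ K).relIndex (toConjAct t' • (P ⊓ K)) * (toConjAct t • (P ⊓ K)).relIndex (P ⊓ K) := mul_comm _ _
    _ = _ := hmain.symm

/-! ## §6 Consequences for the Satake transforms over a commutative ring `R` -/

/-- Coefficients of `ι f`, `ι = domCongr (neg)`: `(ι f)_μ = f_{-μ}`. [cite: CartierCorvallis1979, §IV (4.2)] -/
theorem coeff_domCongr_neg (f : AddMonoidAlgebra R Λ) (μ : Λ) :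
    (AddMonoidAlgebra.domCongr R R (AddEquiv.neg Λ) f).coeff μ = f.coeff (-μ) := by
  rw [AddMonoidAlgebra.coeff_domCongr, AddEquiv.neg_symm, AddEquiv.neg_apply]

/-- **`𝒮_w(T_g) = ι(𝒮_{w'}(T_{g⁻¹}))`, `ι(x^μ) = x^{-μ}`** — the Satake transform intertwines the anti-involution
`T_g ↦ T_{g⁻¹}` (`f ↦ f^∨`) of `ℋ(G, K)` with the antipode of `R[Λ]`, for any pair of weights `w, w'` absorbing the modulus:
`[K_P : K_P ∩ tK_Pt⁻¹] · w(a t) = [tK_Pt⁻¹ : K_P ∩ tK_Pt⁻¹] · w'(-a t)` for `t ∈ P` (e.g. `w = w' = δ^{-1/2}`), the indices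
`[K_P : K_P ∩ tK_Pt⁻¹]` being non-zero-divisors of `R`.  Cartier: `f ↦ Sf` is compatible with `f^∨(g) = f(g⁻¹)` and
`χ ↦ χ⁻¹`. [cite: CartierCorvallis1979, §IV (4.2), Thm. 4.1] [cite: Laumon1995, (4.1.6)] -/
theorem satakeTransform_doubleCosetOperator_eq_domCongr_neg (h : IsIwasawaExponent P K a)
    [IsHeckeTriple (⊤ : Submonoid G) K K]
    (hU : ∀ y ∈ P, a y = 0 → ∃ V : Subgroup G, y ∈ V ∧ P ⊓ K ≤ V ∧ (P ⊓ K).relIndex V ≠ 0)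
    (w w' : Multiplicative Λ →* R)
    (hw : ∀ t ∈ P, (((toConjAct t • (P ⊓ K)).relIndex (P ⊓ K) : ℕ) : R) * w (Multiplicative.ofAdd (a t)) =
      (((P ⊓ K).relIndex (toConjAct t • (P ⊓ K)) : ℕ) : R) * w' (Multiplicative.ofAdd (-a t)))
    (hreg : ∀ t ∈ P, (((toConjAct t • (P ⊓ K)).relIndex (P ⊓ K) : ℕ) : R) ∈ nonZeroDivisors R) (g : G) :
    h.satakeTransform w (heckeAlgebra.doubleCosetOperator K g) =
      AddMonoidAlgebra.domCongr R R (AddEquiv.neg Λ) (h.satakeTransform w' (heckeAlgebra.doubleCosetOperator K g⁻¹)) := by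
  classical
  refine AddMonoidAlgebra.ext (Finsupp.ext fun μ => ?_)
  rw [coeff_domCongr_neg, h.coeff_satakeTransform_doubleCosetOperator, h.coeff_satakeTransform_doubleCosetOperator]
  by_cases hμ : ∃ t ∈ P, a t = μ
  · obtain ⟨t, ht, rfl⟩ := hμ
    have hN := card_filter_mul_relIndex_eq h hU g ht
    have hw' := hw t ht
    refine (mul_cancel_right_mem_nonZeroDivisors (hreg t ht)).1 ?_
    calc ((((finite_orbit_quotient K g).toFinset.filter fun α => a α.out = a t).card : ℕ) : R) *
          w (Multiplicative.ofAdd (a t)) * (((toConjAct t • (P ⊓ K)).relIndex (P ⊓ K) : ℕ) : R)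
        = ((((finite_orbit_quotient K g).toFinset.filter fun α => a α.out = a t).card : ℕ) : R) *
          ((((toConjAct t • (P ⊓ K)).relIndex (P ⊓ K) : ℕ) : R) * w (Multiplicative.ofAdd (a t))) := by ring
      _ = ((((finite_orbit_quotient K g).toFinset.filter fun α => a α.out = a t).card : ℕ) : R) *
          ((((P ⊓ K).relIndex (toConjAct t • (P ⊓ K)) : ℕ) : R) * w' (Multiplicative.ofAdd (-a t))) := by rw [hw']
      _ = ((((finite_orbit_quotient K g).toFinset.filter fun α => a α.out = a t).card *
          (P ⊓ K).relIndex (toConjAct t • (P ⊓ K)) : ℕ) : R) * w' (Multiplicative.ofAdd (-a t)) := by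
          push_cast; ring
      _ = ((((finite_orbit_quotient K g⁻¹).toFinset.filter fun α => a α.out = -a t).card *
          (toConjAct t • (P ⊓ K)).relIndex (P ⊓ K) : ℕ) : R) * w' (Multiplicative.ofAdd (-a t)) := by rw [hN]
      _ = _ := by push_cast; ring
  · push Not at hμ
    have h1 := card_filter_eq_zero_of_forall_ne h g (μ := μ) hμ
    have h2 := card_filter_eq_zero_of_forall_ne h g⁻¹ (μ := -μ) fun p hp hp' =>
      hμ p⁻¹ (P.inv_mem hp) (by rw [h.apply_inv_of_mem_left hp, hp', neg_neg])
    rw [h1, h2, Nat.cast_zero, zero_mul, zero_mul]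

/-- **Self-inverse double cosets ⇒ `𝒮_w(T) = ι(𝒮_{w'}(T))` for every `T`** (linearity and the double-coset basis).  For the
symplectic and unramified unitary groups (`Kg⁻¹K = KgK`) this is the invariance of the Satake image under `w₀ = -1 ∈ W`
twisted by the modulus. [cite: CartierCorvallis1979, §IV Thm. 4.1] -/
theorem satakeTransform_eq_domCongr_neg_of_forall (h : IsIwasawaExponent P K a) [IsHeckeTriple (⊤ : Submonoid G) K K]
    (hU : ∀ y ∈ P, a y = 0 → ∃ V : Subgroup G, y ∈ V ∧ P ⊓ K ≤ V ∧ (P ⊓ K).relIndex V ≠ 0)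
    (w w' : Multiplicative Λ →* R)
    (hw : ∀ t ∈ P, (((toConjAct t • (P ⊓ K)).relIndex (P ⊓ K) : ℕ) : R) * w (Multiplicative.ofAdd (a t)) =
      (((P ⊓ K).relIndex (toConjAct t • (P ⊓ K)) : ℕ) : R) * w' (Multiplicative.ofAdd (-a t)))
    (hreg : ∀ t ∈ P, (((toConjAct t • (P ⊓ K)).relIndex (P ⊓ K) : ℕ) : R) ∈ nonZeroDivisors R)
    (hinv : ∀ g : G, heckeAlgebra.doubleCosetOperator (k := R) K g⁻¹ = heckeAlgebra.doubleCosetOperator K g)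
    (T : heckeAlgebra R G K) :
    h.satakeTransform w T = AddMonoidAlgebra.domCongr R R (AddEquiv.neg Λ) (h.satakeTransform w' T) := by
  have hT := heckeAlgebra.mem_span_range_doubleCosetOperator K T
  induction hT using Submodule.span_induction with
  | mem S hS =>
    obtain ⟨g, rfl⟩ := hS
    rw [satakeTransform_doubleCosetOperator_eq_domCongr_neg h hU w w' hw hreg g, hinv]
  | zero => simp
  | add S S' _ _ hS hS' => rw [map_add, map_add, map_add, hS, hS']
  | smul r S _ hS => rw [map_smul, map_smul, map_smul, hS]

/-- With one symmetric weight (`w = w'`, e.g. `w = δ^{-1/2}` when the modulus has a square root in `R`): **every Satake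
transform is `ι`-invariant.** [cite: CartierCorvallis1979, §IV Thm. 4.1] -/
theorem domCongr_neg_satakeTransform_eq_self (h : IsIwasawaExponent P K a) [IsHeckeTriple (⊤ : Submonoid G) K K]
    (hU : ∀ y ∈ P, a y = 0 → ∃ V : Subgroup G, y ∈ V ∧ P ⊓ K ≤ V ∧ (P ⊓ K).relIndex V ≠ 0)
    (w : Multiplicative Λ →* R)
    (hw : ∀ t ∈ P, (((toConjAct t • (P ⊓ K)).relIndex (P ⊓ K) : ℕ) : R) * w (Multiplicative.ofAdd (a t)) =
      (((P ⊓ K).relIndex (toConjAct t • (P ⊓ K)) : ℕ) : R) * w (Multiplicative.ofAdd (-a t)))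
    (hreg : ∀ t ∈ P, (((toConjAct t • (P ⊓ K)).relIndex (P ⊓ K) : ℕ) : R) ∈ nonZeroDivisors R)
    (hinv : ∀ g : G, heckeAlgebra.doubleCosetOperator (k := R) K g⁻¹ = heckeAlgebra.doubleCosetOperator K g)
    (T : heckeAlgebra R G K) :
    AddMonoidAlgebra.domCongr R R (AddEquiv.neg Λ) (h.satakeTransform w T) = h.satakeTransform w T :=
  (satakeTransform_eq_domCongr_neg_of_forall h hU w w hw hreg hinv T).symm

/-! ## §7 The unimodularity hypothesis from a contracting element -/

omit [Group G] in
/-- Iterated contraction: `tᵏ H t⁻ᵏ ≤ H` if `t H t⁻¹ ≤ H`. [cite: CartierCorvallis1979, §IV (4.2)] -/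
theorem pow_smul_le_of_smul_le {G : Type*} [Group G] {H : Subgroup G} {t : G} (hcon : toConjAct t • H ≤ H) (k : ℕ) :
    toConjAct (t ^ k) • H ≤ H := by
  induction k with
  | zero => simp
  | succ k ih =>
    rw [pow_succ', toConjAct_mul, mul_smul]
    exact (Subgroup.pointwise_smul_le_pointwise_smul_iff.2 ih).trans hcon

/-- **Relative unimodularity of `P ∩ a⁻¹(0)` from a contracting element.**  If some `t ∈ P` has `tK_Pt⁻¹ ≤ K_P` and every
`y ∈ P` with `a y = 0` is conjugated into `K` by a power of `t` (as a strictly dominant coweight does for the kernel of the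
exponent map on a Borel subgroup: `U = ⋃ₖ t⁻ᵏ U(𝒪) tᵏ`), then every such `y` lies in the subgroup `V = t⁻ᵏK_Ptᵏ ⊇ K_P`, of
index `[V : K_P] = [K_P : tᵏK_Pt⁻ᵏ] < ∞`. [cite: CartierCorvallis1979, §I.3, §IV (4.2)] -/
theorem exists_subgroup_relIndex_ne_zero_of_contracting [IsHeckeTriple (⊤ : Submonoid G) K K]
    {t : G} (ht : t ∈ P) (hcon : toConjAct t • (P ⊓ K) ≤ P ⊓ K)
    (hlim : ∀ y ∈ P, a y = 0 → ∃ k : ℕ, toConjAct (t ^ k) • y ∈ K) :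
    ∀ y ∈ P, a y = 0 → ∃ V : Subgroup G, y ∈ V ∧ P ⊓ K ≤ V ∧ (P ⊓ K).relIndex V ≠ 0 := by
  intro y hy hay
  obtain ⟨k, hk⟩ := hlim y hy hay
  have htk : t ^ k ∈ P := P.pow_mem ht k
  refine ⟨(toConjAct (t ^ k))⁻¹ • (P ⊓ K), ?_, ?_, ?_⟩
  · rw [Subgroup.mem_pointwise_smul_iff_inv_smul_mem, inv_inv]
    refine Subgroup.mem_inf.2 ⟨?_, hk⟩
    rw [toConjAct_smul]
    exact P.mul_mem (P.mul_mem htk hy) (P.inv_mem htk)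
  · have hle := Subgroup.pointwise_smul_le_pointwise_smul_iff (a := (toConjAct (t ^ k))⁻¹) |>.2
      (pow_smul_le_of_smul_le hcon k)
    rwa [inv_smul_smul] at hle
  · have e := Subgroup.relIndex_pointwise_smul (toConjAct (t ^ k)) (P ⊓ K) ((toConjAct (t ^ k))⁻¹ • (P ⊓ K))
    rw [smul_inv_smul] at e
    rw [← e, ← relIndex_conj_eq_of_mem htk]
    exact relIndex_conjAct_smul_ne_zero _ inf_le_right

/-! ## §8 The duality extended `R`-linearly to every `T ∈ ℋ(G, K; R)` when all double cosets are self-inverse -/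

/-- **Linear extension of the duality** (self-inverse double cosets), any weight `w`: if `T_{g⁻¹} = T_g` for all `g`, then
for EVERY `T ∈ ℋ(G, K; R)` and `t ∈ P`:
`𝒮_w(T)_{a t} · w(-a t) · [tK_Pt⁻¹ : K_P ∩ tK_Pt⁻¹] = 𝒮_w(T)_{-a t} · w(a t) · [K_P : K_P ∩ tK_Pt⁻¹]` in `R`
(on `T_g` both sides are `w(a t) w(-a t)` times the two sides of the counting duality `card_filter_mul_relIndex_eq`).
[cite: CartierCorvallis1979, §IV (4.2), Thm. 4.1] -/
theorem coeff_satakeTransform_mul_relIndex_eq_of_forall (h : IsIwasawaExponent P K a) [IsHeckeTriple (⊤ : Submonoid G) K K]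
    (hU : ∀ y ∈ P, a y = 0 → ∃ V : Subgroup G, y ∈ V ∧ P ⊓ K ≤ V ∧ (P ⊓ K).relIndex V ≠ 0)
    (hinv : ∀ g : G, heckeAlgebra.doubleCosetOperator (k := R) K g⁻¹ = heckeAlgebra.doubleCosetOperator K g)
    (w : Multiplicative Λ →* R) {t : G} (ht : t ∈ P) (T : heckeAlgebra R G K) :
    (h.satakeTransform w T).coeff (a t) * w (Multiplicative.ofAdd (-a t)) *
        (((P ⊓ K).relIndex (toConjAct t • (P ⊓ K)) : ℕ) : R) =
      (h.satakeTransform w T).coeff (-a t) * w (Multiplicative.ofAdd (a t)) *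
        (((toConjAct t • (P ⊓ K)).relIndex (P ⊓ K) : ℕ) : R) := by
  classical
  have hT := heckeAlgebra.mem_span_range_doubleCosetOperator K T
  induction hT using Submodule.span_induction with
  | mem S hS =>
    obtain ⟨g, rfl⟩ := hS
    have hN := congrArg (Nat.cast : ℕ → R) (h.card_filter_mul_relIndex_eq hU g ht)
    push_cast at hN
    have e : (h.satakeTransform w (heckeAlgebra.doubleCosetOperator K g)).coeff (-a t) =
        (h.satakeTransform w (heckeAlgebra.doubleCosetOperator K g⁻¹)).coeff (-a t) := by
      rw [hinv]
    rw [e, h.coeff_satakeTransform_doubleCosetOperator, h.coeff_satakeTransform_doubleCosetOperator]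
    linear_combination (w (Multiplicative.ofAdd (a t)) * w (Multiplicative.ofAdd (-a t))) * hN
  | zero => simp
  | add S S' _ _ hS hS' =>
    rw [map_add, AddMonoidAlgebra.coeff_add, Finsupp.add_apply, Finsupp.add_apply]
    linear_combination hS + hS'
  | smul r S _ hS =>
    rw [map_smul, AddMonoidAlgebra.coeff_smul, Finsupp.smul_apply, Finsupp.smul_apply, smul_eq_mul, smul_eq_mul]
    linear_combination r * hS

/-- Weight `1` (the COUNTING transform): if `T_{g⁻¹} = T_g` for all `g`, then for every `T ∈ ℋ(G, K; R)` and `t ∈ P`,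
`𝒮_1(T)_{a t} · [tK_Pt⁻¹ : K_P ∩ tK_Pt⁻¹] = 𝒮_1(T)_{-a t} · [K_P : K_P ∩ tK_Pt⁻¹]` in `R`.
[cite: CartierCorvallis1979, §IV (4.2), Thm. 4.1] -/
theorem coeff_satakeTransform_one_mul_relIndex_eq_of_forall (h : IsIwasawaExponent P K a)
    [IsHeckeTriple (⊤ : Submonoid G) K K]
    (hU : ∀ y ∈ P, a y = 0 → ∃ V : Subgroup G, y ∈ V ∧ P ⊓ K ≤ V ∧ (P ⊓ K).relIndex V ≠ 0)
    (hinv : ∀ g : G, heckeAlgebra.doubleCosetOperator (k := R) K g⁻¹ = heckeAlgebra.doubleCosetOperator K g)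
    {t : G} (ht : t ∈ P) (T : heckeAlgebra R G K) :
    (h.satakeTransform (1 : Multiplicative Λ →* R) T).coeff (a t) *
        (((P ⊓ K).relIndex (toConjAct t • (P ⊓ K)) : ℕ) : R) =
      (h.satakeTransform (1 : Multiplicative Λ →* R) T).coeff (-a t) *
        (((toConjAct t • (P ⊓ K)).relIndex (P ⊓ K) : ℕ) : R) := by
  have key := h.coeff_satakeTransform_mul_relIndex_eq_of_forall hU hinv 1 ht T
  rwa [MonoidHom.one_apply, MonoidHom.one_apply, mul_one, mul_one] at key

end IsIwasawaExponent

end Literature.NumberTheory.Automorphic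

end
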